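import Mathlib
import Literature.NumberTheory.LFunctions.Zhang2022.Section15CalM1Ratio
import Literature.Analysis.Complex.HolomorphicProducts
import HarnessLib

/-!
# Zhang (2022), §15 pp. 84–87: a uniform LOWER bound for the Euler factors `F_q(1,1;1−βⱼ)` of
# `𝓜₁(1,1;1−βⱼ)` — kernel-checked helper for Lemma 15.3 (repaired, leaf `h153RpI`)

Topic `Literature/NumberTheory/LFunctions/Zhang2022` (Landau–Siegel audit tree; verdict-neutral).
Y. Zhang, *Discrete mean estimates and the Landau–Siegel zero*, arXiv:2211.02515v1 (2022)
[Zhang2022LandauSiegel], §15 p. 84 (the Euler product of `𝓜₁`, tex L4190–L4212) and Lemma 15.3 p. 87 /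
App. A p. 105, **an unrefereed manuscript under adjudication; nothing here asserts or denies its
Theorems 1–2.** The repaired Euler factor `𝔲ᴿ₁ⱼ(q,s)` of Lemma 15.3 is a polynomial in `q^{−s}` whose
coefficients are the RATIOS `F_q(1,q)/F_q(1,1)`, `λ₁(q)F_q(q,1)/F_q(1,1)`, `λ₁(q)F_q(q,q)/F_q(1,1)` of
local factors of `𝓜₁` at `s₀ = 1 − βⱼ` (`Lemma153Rp.frakU1FactorR_eq_poly`, zl-w15-p7); to bound them
(row G-d52-1's estimate `‖𝔲ᴿ − 1‖ ≤ C(q^{−2σ} + q^{−1−σ})`) one needs the denominator bounded BELOW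
uniformly in `q` and `D`.

This file PROVES (theorems only, no definitions, no facts):
**`norm_calM1Factor_one_one_betaJ_ge`** — there is an absolute `c₀ > 0` with, for all large `D`
under (A), `1 ≤ j ≤ 3` and EVERY prime `q`: `‖F_q(1,1;1−βⱼ)‖ ≥ c₀`. Proof: `𝓜₁(1,1;s₀) = F_q·∏'_{p≠q}F_p`
with `‖𝓜₁(1,1;s₀)‖ ≥ 1/2` (`Section15B.norm_calM1_one_one_betaJ_ge`, Lemma 15.2) and
`‖∏'_{p≠q}F_p‖ ≤ exp(C₃₂ Σ_p p^{−19/10})` (u032 `step15_u032_holds`: `‖F_p(1,1;s₀) − 1‖ ≤ C₃₂p^{−19/10}`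
as `(p, 1·1) = 1`; `Literature.Analysis.Complex.norm_tprod_le_exp_tsum_const`), so
`c₀ = 1/(2·exp(C₃₂ζ(19/10)))` works. WHAT THIS IS NOT: anything about Theorems 1–2.

## References

* Y. Zhang, arXiv:2211.02515v1 (2022), §15 p. 84, Lemma 15.2–15.3 p. 87. [cite: Zhang2022LandauSiegel, §15 p. 84]
-/

noncomputable section

open Complex Real Filter Topology

namespace Literature.NumberTheory.LFunctions.Zhang2022.Typed.Section15B

open Literature.NumberTheory.LFunctions.Zhang2022
open Literature.NumberTheory.LFunctions.Zhang2022.Skeleton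

/-- **Uniform lower bound for the local factors of `𝓜₁(1,1;1−βⱼ)`**: an absolute `c₀ > 0` with
`‖calM1Factor c′ χ q 1 1 (1−βⱼ)‖ ≥ c₀` for all large `D`, under (A), `1 ≤ j ≤ 3`, every prime `q`
(`𝓜₁(1,1) = F_q·∏_{p≠q}F_p`, `‖𝓜₁(1,1)‖ ≥ 1/2`, `‖∏_{p≠q}F_p‖ ≤ e^{C₃₂ζ(19/10)}`).
[cite: Zhang2022LandauSiegel, §15 p. 84, Lemma 15.2 p. 87] -/
theorem norm_calM1Factor_one_one_betaJ_ge (c' : ℝ) :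
    ∃ c₀ : ℝ, 0 < c₀ ∧ ForAllLarge fun D _ χ => AssumptionA D χ → ∀ j ∈ ({1, 2, 3} : Finset ℕ),
      ∀ q : ℕ, q.Prime → c₀ ≤ ‖calM1Factor c' χ q 1 1 (1 - betaJ c' D j)‖ := by
  classical
  obtain ⟨C, h32⟩ := step15_u032_holds c'
  set C' : ℝ := max C 0 with hC'def
  have hC'0 : 0 ≤ C' := le_max_right _ _
  have hZsum : Summable fun n : ℕ => (n : ℝ) ^ (-(19 / 10 : ℝ)) :=
    Real.summable_nat_rpow.mpr (by norm_num)
  set Z : ℝ := ∑' n : ℕ, (n : ℝ) ^ (-(19 / 10 : ℝ)) with hZdef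
  have hZ0 : 0 ≤ Z := tsum_nonneg fun n => Real.rpow_nonneg (Nat.cast_nonneg n) _
  set c₀ : ℝ := 1 / (2 * Real.exp (C' * Z)) with hc₀def
  refine ⟨c₀, by positivity, (h32.and (norm_calM1_one_one_betaJ_ge c')).mono
    fun D _ χ _ _ hS hA j hj q hq => ?_⟩
  obtain ⟨h32D, hM0D⟩ := hS
  obtain ⟨-, hre1, hM0⟩ := hM0D hA j hj
  set s₀ : ℂ := 1 - betaJ c' D j with hs₀def
  have hs₀ : 9 / 10 < s₀.re := by rw [hre1]; norm_num
  -- the factors and the majorant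
  set F : Nat.Primes → ℂ := fun p => calM1Factor c' χ (p : ℕ) 1 1 s₀ with hFdef
  set b : Nat.Primes → ℝ := fun p => C' * ((p : ℕ) : ℝ) ^ (-(19 / 10 : ℝ)) with hbdef
  have hbsum : Summable b := (hZsum.comp_injective Subtype.val_injective).mul_left _
  have hFb : ∀ p : Nat.Primes, ‖F p - 1‖ ≤ b p := fun p => by
    have hcop : Nat.Coprime (p : ℕ) (1 * 1) := by simp
    have h := h32D hA (p : ℕ) 1 1 p.prop le_rfl le_rfl hcop s₀ hs₀
    exact h.trans (mul_le_mul_of_nonneg_right (le_max_left _ _)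
      (Real.rpow_nonneg (Nat.cast_nonneg _) _))
  -- remove the factor at `q`
  set q₀ : Nat.Primes := ⟨q, hq⟩ with hq₀def
  set G : Nat.Primes → ℂ := fun p => if p = q₀ then 1 else F p with hGdef
  have hGb : ∀ p : Nat.Primes, ‖G p - 1‖ ≤ b p := fun p => by
    by_cases hp : p = q₀
    · simp only [hGdef, if_pos hp, sub_self, norm_zero, hbdef]; positivity
    · simp only [hGdef, if_neg hp]; exact hFb p
  have hGmul : Multipliable G :=
    Literature.Analysis.Complex.multipliable_of_norm_sub_one_le_const hbsum hGb
  have hupd : Function.update F q₀ 1 = G := by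
    funext p
    simp only [Function.update_apply, hGdef]
  have hsplit : (∏' p, F p) = F q₀ * ∏' p, G p := by
    have h := Multipliable.tprod_eq_mul_tprod_ite' (f := F) q₀ (hupd ▸ hGmul)
    rw [h]
  have hGnorm : ‖∏' p, G p‖ ≤ Real.exp (C' * Z) := by
    refine (Literature.Analysis.Complex.norm_tprod_le_exp_tsum_const hbsum hGb).trans ?_
    refine Real.exp_le_exp.mpr ?_
    have h1 : ∑' p : Nat.Primes, b p = C' * ∑' p : Nat.Primes, ((p : ℕ) : ℝ) ^ (-(19 / 10 : ℝ)) :=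
      tsum_mul_left
    have h2 : ∑' p : Nat.Primes, ((p : ℕ) : ℝ) ^ (-(19 / 10 : ℝ)) ≤ Z :=
      (hZsum.comp_injective Subtype.val_injective).tsum_le_tsum_of_inj
        (fun p : Nat.Primes => (p : ℕ)) Subtype.val_injective
        (fun n _ => Real.rpow_nonneg (Nat.cast_nonneg n) _) (fun p => le_rfl) hZsum
    rw [h1]; exact mul_le_mul_of_nonneg_left h2 hC'0
  -- `‖𝓜₁(1,1;s₀)‖ ≥ 1/2`
  have hM : calM1 c' χ 1 1 s₀ = ∏' p, F p := rfl
  have hkey : 1 / 2 ≤ ‖F q₀‖ * Real.exp (C' * Z) := by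
    calc (1 : ℝ) / 2 ≤ ‖calM1 c' χ 1 1 s₀‖ := hM0
      _ = ‖F q₀‖ * ‖∏' p, G p‖ := by rw [hM, hsplit, norm_mul]
      _ ≤ ‖F q₀‖ * Real.exp (C' * Z) := mul_le_mul_of_nonneg_left hGnorm (norm_nonneg _)
  have hexp : 0 < Real.exp (C' * Z) := Real.exp_pos _
  show c₀ ≤ ‖calM1Factor c' χ q 1 1 s₀‖
  have hFq : calM1Factor c' χ q 1 1 s₀ = F q₀ := rfl
  rw [hFq, hc₀def, div_le_iff₀ (by positivity)]
  nlinarith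

end Literature.NumberTheory.LFunctions.Zhang2022.Typed.Section15B

end
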